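import Literature.NumberTheory.Automorphic.InfUnitaryWeakAdIdentity
import Literature.NumberTheory.Automorphic.GKModulesKActionAlongCurves
import Literature.RepresentationTheory.KonnoKonno2007.RealUnitaryRankOneKAKDescent
import HarnessLib

/-!
# The torus translation law of the `KAK`-descended operator family, II: the derivative of the matrix coefficients off `K`
# (`d/dσ ⟪Φ(g a_σ) ι u, ι w⟫ = ⟪Φ(g a_σ) ι(ρ H₀ u), ι w⟫` from a differentiable `KAK` section along `s ↦ g a_s`)

Topic `NumberTheory/Automorphic`; namespace `Literature.NumberTheory.Automorphic.IsPosDefHerm` (companion of ★ `UpqGlobalizationTorusLaw` (Φ2-core: the torus law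
`Φ(g a_s) = Φ(g) ∘ U₀(s)` from the matrix-coefficient ODE off `K`), ★ `InfUnitaryWeakAdIdentity` (P3: the weak `Ad`-identity), ★
`GKModulesKActionAlongCurves` (KD: `K`-derivatives along differentiable curves, A-p14 (g24)) and ★ `RealUnitaryRankOneKAKDescent` (Φ1: `globOp`)).
THEOREMS ONLY; no definition, no instance, no notation, no named fact, no `sorry`.  Cell `hodgecm-mathlib`, F0∕P3, in-house road to the letter A6
`HasUnitaryGlobalizationOfInfUnitary` at `U(2,1)` (ROAD-GLOB v1.1, brick Φ2-diff, T1a LEAD F0P3b-p01 (g3)).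

THE MATHEMATICS ([HarishChandra1953, §9]; [Knapp2002, VII §3]).  `Φ = globOp p₀ q₀ ϖK U₀` with `ϖK = hB.kRep ρK`, `U₀ = hB.U ρ K H₀`.  Near a parameter
`s₀` with `g a_{s₀} ∉ K` suppose a DIFFERENTIABLE `KAK` section of the curve is given: `g a_s = k₁(s) a_{τ(s)} k₂(s)` for `s` near `s₀` with
`maximalCompact`-valued `k₁, k₂`, left logarithmic derivatives `Y₂ = k₂⁻¹k₂'`, `Y₁' = (k₁⁻¹)⁻¹(k₁⁻¹)' = −Ad(k₁) Y₁` in `𝔨`, `τ'`, and the derivative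
identity (E1) `Ad(a_{−τ}) Y₁ + τ' H₀ + Ad(k₂) Y₂ = Ad(k₂) H₀` (this geometric input is brick Φ2-geom, proved at `U(2,1)` from B-p17's explicit section ★
`U21KAKSection*`).  Then for all `u, w ∈ V`

  `d/dσ|_{σ=s₀} ⟪Φ(g a_σ) ι u, ι w⟫ = ⟪Φ(g a_{s₀}) ι(ρ H₀ u), ι w⟫`   (`hasDerivAt_inner_globOp_mul_hypV`):

locally `⟪Φ(g a_σ) ι u, ι w⟫ = ⟪U₀(τ σ) ι(ρ_K(k₂ σ) u), ι(ρ_K(k₁ σ)⁻¹ w)⟫` (★ `globOp_kakMap`, unitarity of `ϖK`); the three-factor Leibniz rule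
`hasDerivAt_inner_family_apply` (strongly continuous contractions differentiable on the fixed vector) with KD on `k₂` and on `k₁⁻¹`, (U4) along `τ`,
then `ad_compat`, the weak `Ad`-identity P3 for the `k₁`-term and (E1) reassemble the derivative into `⟪U₀(τ) ι(ρ_K(k₂)(ρ H₀ u)), ι(ρ_K(k₁)⁻¹ w)⟫`.

## Mathlib ∕ tree search
Tree: ★ `globOp_kakMap` (Φ1), ★ `kRep_emb`, `kRep_mem_unitary`, `norm_U`, `continuous_U_apply`, `hasDerivAt_U_emb`, `lineBound_of_FB` (A-p14), ★ KD
`IsGKModule.hasDerivAt_map_curve`, ★ P3 `inner_U_emb_Ad`, ★ `IsGKModule.ad_compat`, ★ `kV_upqKBlock` ∕ `upqMaximalCompactEquiv`.  Mathlib: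
`HasDerivAt.inner`, `hasDerivAt_iff_tendsto_slope`, `ContinuousLinearMap.inner_map_map_of_mem_unitary`.  Dedup: `rg "hasDerivAt_inner_globOp" Literature/` — none.

## References
* Harish-Chandra, *Representations of a semisimple Lie group on a Banach space. I*, Trans. AMS 75 (1953), §9 [HarishChandra1953].
* A. W. Knapp, *Lie Groups Beyond an Introduction*, 2nd ed. (2002), VII §3, Thm. 7.39 [Knapp2002].
-/

set_option autoImplicit false

noncomputable section

attribute [local instance 100] LieRing.ofAssociativeRing

open Finset Set Filter Complex
open scoped Nat InnerProductSpace ComplexConjugate Matrix.Norms.Operator Topology MatrixGroups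

namespace Literature.NumberTheory.Automorphic

namespace IsPosDefHerm

open Literature.RepresentationTheory.KonnoKonno2007 Literature.RepresentationTheory.KonnoKonno2007.RealDualPair
open Literature.RepresentationTheory.KonnoKonno2007.RealDualPair.UForm Literature.RepresentationTheory.BorelWallach2000

universe u

/-! ## §1 A Leibniz rule: `σ ↦ ⟪B(σ) x(σ), y(σ)⟫` for a strongly continuous bounded family differentiable on the fixed vector `x(s)` -/

section Leibniz

variable {E : Type*} [NormedAddCommGroup E] [InnerProductSpace ℂ E]

/-- **Leibniz rule for `⟪B(σ) x(σ), y(σ)⟫`.**  Let `B : ℝ → (E →L[ℂ] E)` be uniformly bounded (`‖B σ‖ ≤ M`) and strongly continuous at `s`, `x, y : ℝ → E`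
differentiable at `s`, and suppose the orbit of the FIXED vector `x s` is differentiable, `HasDerivAt (σ ↦ B σ (x s)) z s`.  Then
`d/dσ ⟪B σ (x σ), y σ⟫|_s = ⟪z, y s⟫ + ⟪B s x', y s⟫ + ⟪B s (x s), y'⟫` (no norm-differentiability of `B` is needed). [cite: HarishChandra1953, §9] -/
theorem hasDerivAt_inner_family_apply (B : ℝ → (E →L[ℂ] E)) {M : ℝ} (hBb : ∀ σ, ‖B σ‖ ≤ M) {s : ℝ}
    (hBc : ∀ v, ContinuousAt (fun σ => B σ v) s) {x y : ℝ → E} {x' y' z : E}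
    (hx : HasDerivAt x x' s) (hy : HasDerivAt y y' s) (hBx : HasDerivAt (fun σ => B σ (x s)) z s) :
    HasDerivAt (fun σ => ⟪B σ (x σ), y σ⟫_ℂ) (⟪z, y s⟫_ℂ + ⟪B s x', y s⟫_ℂ + ⟪B s (x s), y'⟫_ℂ) s := by
  have hM : 0 ≤ M := (norm_nonneg _).trans (hBb s)
  -- split `B σ (x σ) = B σ (x s) + B σ (x σ − x s)`
  have hsplit : (fun σ => ⟪B σ (x σ), y σ⟫_ℂ) = fun σ => ⟪B σ (x s), y σ⟫_ℂ + ⟪B σ (x σ - x s), y σ⟫_ℂ := by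
    funext σ; rw [← inner_add_left, ← map_add, add_sub_cancel]
  rw [hsplit]
  have h1 : HasDerivAt (fun σ => ⟪B σ (x s), y σ⟫_ℂ) (⟪B s (x s), y'⟫_ℂ + ⟪z, y s⟫_ℂ) s := hBx.inner ℂ hy
  -- the remainder term has derivative `⟪B s x', y s⟫`
  have h2 : HasDerivAt (fun σ => ⟪B σ (x σ - x s), y σ⟫_ℂ) (⟪B s x', y s⟫_ℂ) s := by
    rw [hasDerivAt_iff_tendsto_slope]
    have hslope : ∀ σ, slope (fun σ => ⟪B σ (x σ - x s), y σ⟫_ℂ) s σ = ⟪B σ (slope x s σ), y σ⟫_ℂ := by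
      intro σ
      rw [slope_def_module, slope_def_module, sub_self, map_zero, inner_zero_left, sub_zero, ContinuousLinearMap.map_smul_of_tower,
        RCLike.real_smul_eq_coe_smul (K := ℂ) (σ - s)⁻¹ (B σ (x σ - x s)), inner_smul_real_left]
    rw [show slope (fun σ => ⟪B σ (x σ - x s), y σ⟫_ℂ) s = fun σ => ⟪B σ (slope x s σ), y σ⟫_ℂ from funext hslope]
    -- `B σ (slope x s σ) → B s x'` and `y σ → y s`
    have hq : Tendsto (slope x s) (𝓝[≠] s) (𝓝 x') := hx.tendsto_slope
    have hBq : Tendsto (fun σ => B σ (slope x s σ)) (𝓝[≠] s) (𝓝 (B s x')) := by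
      rw [tendsto_iff_norm_sub_tendsto_zero]
      have hb1 : Tendsto (fun σ => M * ‖slope x s σ - x'‖ + ‖B σ x' - B s x'‖) (𝓝[≠] s) (𝓝 0) := by
        have ha : Tendsto (fun σ => M * ‖slope x s σ - x'‖) (𝓝[≠] s) (𝓝 0) := by
          have := (tendsto_iff_norm_sub_tendsto_zero.1 hq).const_mul M
          simpa using this
        have hb : Tendsto (fun σ => ‖B σ x' - B s x'‖) (𝓝[≠] s) (𝓝 0) :=
          tendsto_iff_norm_sub_tendsto_zero.1 ((hBc x').tendsto.mono_left nhdsWithin_le_nhds)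
        simpa using ha.add hb
      refine squeeze_zero (fun σ => norm_nonneg _) (fun σ => ?_) hb1
      calc ‖B σ (slope x s σ) - B s x'‖ = ‖B σ (slope x s σ - x') + (B σ x' - B s x')‖ := by rw [map_sub]; abel_nf
        _ ≤ ‖B σ (slope x s σ - x')‖ + ‖B σ x' - B s x'‖ := norm_add_le _ _
        _ ≤ M * ‖slope x s σ - x'‖ + ‖B σ x' - B s x'‖ := by gcongr; exact (B σ).le_of_opNorm_le (hBb σ) _
    have hyc : Tendsto y (𝓝[≠] s) (𝓝 (y s)) := hy.continuousAt.tendsto.mono_left nhdsWithin_le_nhds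
    exact hBq.inner hyc
  exact (h1.add h2).congr_deriv (by abel)

end Leibniz

/-! ## §2 The derivative of the matrix coefficients of `globOp` along `s ↦ g a_s` off `K` -/

section Deriv

variable {α β : Type*} [Fintype α] [DecidableEq α] [Fintype β] [DecidableEq β] (p₀ : α) (q₀ : β)
  {V : Type u} [AddCommGroup V] [Module ℂ V] {B : V →ₗ⋆[ℂ] V →ₗ[ℂ] ℂ} (hB : IsPosDefHerm B)
include hB

variable {ρK : Representation ℂ (uFormGroup α β).maximalCompact V} {ρ : (uFormGroup α β).lie →ₗ⁅ℝ⁆ Module.End ℂ V}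

/-- `⟪ϖK k x, y⟫ = ⟪x, ϖK k⁻¹ y⟫` for the unitary `K`-action `ϖK = hB.kRep ρK`. [cite: KnappVogan1995, Introduction Thm. 0.6] -/
theorem inner_kRep_apply_left (hinv : ∀ (k : (uFormGroup α β).maximalCompact) (x y : V), B (ρK k x) (ρK k y) = B x y)
    (k : (uFormGroup α β).maximalCompact) (x y : hB.E) :
    ⟪hB.kRep ρK hinv k x, y⟫_ℂ = ⟪x, hB.kRep ρK hinv k⁻¹ y⟫_ℂ := by
  have hy : y = hB.kRep ρK hinv k (hB.kRep ρK hinv k⁻¹ y) := by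
    rw [← ContinuousLinearMap.comp_apply, ← ContinuousLinearMap.mul_def, ← map_mul, mul_inv_cancel, map_one]; rfl
  conv_lhs => rw [hy]
  exact ContinuousLinearMap.inner_map_map_of_mem_unitary (hB.kRep_mem_unitary ρK hinv k) _ _

omit hB in
/-- `ρ_K(k)(ρ(X) v) = ρ(Ad(k) X)(ρ_K(k) v)` (★ `IsGKModule.ad_compat`, applied form). [cite: KnappVogan1995, §I.4 (1.64)] -/
theorem rhoK_rho_apply (hV : IsGKModule (uFormGroup α β) ρK ρ) (k : (uFormGroup α β).maximalCompact) (X : (uFormGroup α β).lie) (v : V) :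
    ρK k (ρ X v) = ρ ((uFormGroup α β).Ad (Subgroup.inclusion (uFormGroup α β).maximalCompact_le_carrier k) X) (ρK k v) := by
  have h := LinearMap.congr_fun (hV.ad_compat k X) (ρK k v)
  simp only [LinearMap.coe_comp, Function.comp_apply] at h
  have hkk : ρK k⁻¹ (ρK k v) = v := by
    rw [← Module.End.mul_apply, ← map_mul, inv_mul_cancel, map_one, Module.End.one_apply]
  rw [hkk] at h
  exact h

/-- **THE DERIVATIVE OF THE MATRIX COEFFICIENTS OF `globOp` ALONG `s ↦ g a_s` OFF `K`.**  With `ϖK = hB.kRep ρK`, `U₀ = hB.U ρ K H₀`,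
`Φ = globOp p₀ q₀ ϖK U₀` (★ Φ1) and a differentiable `KAK` section of the curve near `s₀` — `g a_s = k₁(s) a_{τ(s)} k₂(s)` eventually, left log-derivatives
`Y₂` of `k₂` and `Y₁'` of `k₁⁻¹` with `Y₁' = −Ad(k₁) Y₁`, `τ'`, and the identity (E1) `Ad(a_{−τ}) Y₁ + τ' H₀ + Ad(k₂) Y₂ = Ad(k₂) H₀` — one has
`d/dσ|_{s₀} ⟪Φ(g a_σ) ι u, ι w⟫ = ⟪Φ(g a_{s₀}) ι(ρ H₀ u), ι w⟫`: the hypothesis `hder` of ★ `eq_comp_U_of_hasDerivAt_inner` at `s₀`.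
[cite: HarishChandra1953, §9] [cite: Knapp2002, VII §3 Thm. 7.39] -/
theorem hasDerivAt_inner_globOp_mul_hypV [Subsingleton β]
    (hreg : ∀ X : Matrix (α ⊕ β) (α ⊕ β) ℂ, (∀ t : ℝ, expGL (t • X) ∈ (uFormGroup α β).carrier) → X ∈ (uFormGroup α β).lie)
    (hV : IsGKModule (uFormGroup α β) ρK ρ)
    (hinv : ∀ (k : (uFormGroup α β).maximalCompact) (x y : V), B (ρK k x) (ρK k y) = B x y)
    {K : ℝ} (hK : 0 < K) (hskew : ∀ (X : (uFormGroup α β).lie) (x y : V), B (ρ X x) y = -B x (ρ X y))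
    (hFB : ∀ v : V, ∃ C : ℝ, ∀ (m : ℕ) (X : Fin m → (uFormGroup α β).lie),
      ‖hB.emb ((List.ofFn fun i => (ρ (X i) : V →ₗ[ℂ] V)).prod v)‖ ≤ C * m ! * K ^ m * ∏ i, ‖((X i : (uFormGroup α β).lie) : Matrix (α ⊕ β) (α ⊕ β) ℂ)‖)
    (hM : ∀ (m : KV α β) (t : ℝ), 0 < t →
      (((kV α β m : UForm α β) : GL (α ⊕ β) ℂ) : Matrix (α ⊕ β) (α ⊕ β) ℂ) *
          ((upqUnit (p₀, q₀) (-I) : (uFormGroup α β).lie) : Matrix (α ⊕ β) (α ⊕ β) ℂ) =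
        ((upqUnit (p₀, q₀) (-I) : (uFormGroup α β).lie) : Matrix (α ⊕ β) (α ⊕ β) ℂ) *
          (((kV α β m : UForm α β) : GL (α ⊕ β) ℂ) : Matrix (α ⊕ β) (α ⊕ β) ℂ) →
      hB.kRep ρK hinv (upqMaximalCompactEquiv.symm m) ∘L hB.U ρ K (upqUnit (p₀, q₀) (-I)) t =
        hB.U ρ K (upqUnit (p₀, q₀) (-I)) t ∘L hB.kRep ρK hinv (upqMaximalCompactEquiv.symm m))
    (hW : ∀ t : ℝ, hB.kRep ρK hinv (upqMaximalCompactEquiv.symm (weylKV p₀ : KV α β)) ∘L hB.U ρ K (upqUnit (p₀, q₀) (-I)) t =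
      hB.U ρ K (upqUnit (p₀, q₀) (-I)) (-t) ∘L hB.kRep ρK hinv (upqMaximalCompactEquiv.symm (weylKV p₀ : KV α β)))
    (g : UForm α β) {s₀ : ℝ}
    (k₁ k₂ : ℝ → (uFormGroup α β).maximalCompact) (τ : ℝ → ℝ) (Y₁ Y₁' Y₂ : (uFormGroup α β).compactLie) (τ' : ℝ)
    (hγ : ∀ᶠ s in 𝓝 s₀, g * hypV p₀ q₀ s = kakMap p₀ q₀ (upqMaximalCompactEquiv (k₁ s), τ s, upqMaximalCompactEquiv (k₂ s)))
    (hk₁' : HasDerivAt (fun s => ((((k₁ s)⁻¹ : (uFormGroup α β).maximalCompact) : GL (α ⊕ β) ℂ) : Matrix (α ⊕ β) (α ⊕ β) ℂ))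
      (((((k₁ s₀)⁻¹ : (uFormGroup α β).maximalCompact) : GL (α ⊕ β) ℂ) : Matrix (α ⊕ β) (α ⊕ β) ℂ) * (Y₁' : Matrix (α ⊕ β) (α ⊕ β) ℂ)) s₀)
    (hY₁' : (LieSubalgebra.inclusion (uFormGroup α β).compactLie_le_lie Y₁' : (uFormGroup α β).lie) =
      -(uFormGroup α β).Ad (Subgroup.inclusion (uFormGroup α β).maximalCompact_le_carrier (k₁ s₀))
        (LieSubalgebra.inclusion (uFormGroup α β).compactLie_le_lie Y₁))
    (hk₂ : HasDerivAt (fun s => (((k₂ s : (uFormGroup α β).maximalCompact) : GL (α ⊕ β) ℂ) : Matrix (α ⊕ β) (α ⊕ β) ℂ))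
      ((((k₂ s₀ : (uFormGroup α β).maximalCompact) : GL (α ⊕ β) ℂ) : Matrix (α ⊕ β) (α ⊕ β) ℂ) * (Y₂ : Matrix (α ⊕ β) (α ⊕ β) ℂ)) s₀)
    (hτ : HasDerivAt τ τ' s₀)
    (hE1 : (uFormGroup α β).Ad ((uFormGroup α β).expMem ((-τ s₀) • upqUnit (p₀, q₀) (-I)))
        (LieSubalgebra.inclusion (uFormGroup α β).compactLie_le_lie Y₁) + τ' • upqUnit (p₀, q₀) (-I) +
        (uFormGroup α β).Ad (Subgroup.inclusion (uFormGroup α β).maximalCompact_le_carrier (k₂ s₀))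
          (LieSubalgebra.inclusion (uFormGroup α β).compactLie_le_lie Y₂) =
      (uFormGroup α β).Ad (Subgroup.inclusion (uFormGroup α β).maximalCompact_le_carrier (k₂ s₀)) (upqUnit (p₀, q₀) (-I)))
    (u w : V) :
    HasDerivAt (fun σ : ℝ => ⟪globOp p₀ q₀ (hB.kRep ρK hinv) (hB.U ρ K (upqUnit (p₀, q₀) (-I))) (g * hypV p₀ q₀ σ) (hB.emb u), hB.emb w⟫_ℂ)
      (⟪globOp p₀ q₀ (hB.kRep ρK hinv) (hB.U ρ K (upqUnit (p₀, q₀) (-I))) (g * hypV p₀ q₀ s₀) (hB.emb (ρ (upqUnit (p₀, q₀) (-I)) u)), hB.emb w⟫_ℂ)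
      s₀ := by
  -- abbreviations
  set H₀ : (uFormGroup α β).lie := upqUnit (p₀, q₀) (-I) with hH₀
  set ϖK := hB.kRep ρK hinv with hϖK
  set U₀ : ℝ → (hB.E →L[ℂ] hB.E) := fun t => hB.U ρ K H₀ t with hU₀def
  set Φ := globOp p₀ q₀ ϖK (hB.U ρ K H₀) with hΦ
  have hbH : ∀ v : V, ∃ C : ℝ, ∀ n, ‖hB.emb (((ρ H₀ : V →ₗ[ℂ] V) ^ n) v)‖ ≤ C * n ! * (K * ‖(H₀ : Matrix (α ⊕ β) (α ⊕ β) ℂ)‖) ^ n :=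
    hB.lineBound_of_FB ρ hFB H₀
  have hXH := hskew H₀
  -- (1) the local formula: `Φ(g a_σ) = ϖK(k₁ σ) ∘ U₀(τ σ) ∘ ϖK(k₂ σ)` near `s₀`
  have hloc : ∀ᶠ σ in 𝓝 s₀, Φ (g * hypV p₀ q₀ σ) = ϖK (k₁ σ) ∘L hB.U ρ K H₀ (τ σ) ∘L ϖK (k₂ σ) := by
    filter_upwards [hγ] with σ hσ
    rw [hσ, hΦ, globOp_kakMap p₀ q₀ (hB.U_zero hK.le hXH hbH) hM hW]
    simp only [hϖK, ContinuousMulEquiv.symm_apply_apply]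
  -- hence the local formula for the matrix coefficient
  have hcoef : ∀ᶠ σ in 𝓝 s₀, ⟪Φ (g * hypV p₀ q₀ σ) (hB.emb u), hB.emb w⟫_ℂ =
      ⟪hB.U ρ K H₀ (τ σ) (hB.emb (ρK (k₂ σ) u)), hB.emb (ρK (k₁ σ)⁻¹ w)⟫_ℂ := by
    filter_upwards [hloc] with σ hσ
    rw [hσ, ContinuousLinearMap.comp_apply, ContinuousLinearMap.comp_apply, hB.kRep_emb, hB.inner_kRep_apply_left hinv, hB.kRep_emb]
  -- the same at `s₀` for the target, with `u ↦ ρ H₀ u`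
  have hcoef₀ : ⟪Φ (g * hypV p₀ q₀ s₀) (hB.emb (ρ H₀ u)), hB.emb w⟫_ℂ =
      ⟪hB.U ρ K H₀ (τ s₀) (hB.emb (ρK (k₂ s₀) (ρ H₀ u))), hB.emb (ρK (k₁ s₀)⁻¹ w)⟫_ℂ := by
    rw [hloc.self_of_nhds, ContinuousLinearMap.comp_apply, ContinuousLinearMap.comp_apply, hB.kRep_emb, hB.inner_kRep_apply_left hinv,
      hB.kRep_emb]
  refine HasDerivAt.congr_of_eventuallyEq ?_ hcoef
  rw [hcoef₀]
  -- (2) the Leibniz rule with `B σ = U₀ (τ σ)`, `x σ = ι(ρK (k₂ σ) u)`, `y σ = ι(ρK (k₁ σ)⁻¹ w)`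
  have hx : HasDerivAt (fun σ => hB.emb (ρK (k₂ σ) u))
      (hB.emb (ρK (k₂ s₀) (ρ (LieSubalgebra.inclusion (uFormGroup α β).compactLie_le_lie Y₂) u))) s₀ :=
    IsGKModule.hasDerivAt_map_curve hreg hV hk₂ hB.emb u
  have hy : HasDerivAt (fun σ => hB.emb (ρK (k₁ σ)⁻¹ w))
      (hB.emb (ρK (k₁ s₀)⁻¹ (ρ (LieSubalgebra.inclusion (uFormGroup α β).compactLie_le_lie Y₁') w))) s₀ :=
    IsGKModule.hasDerivAt_map_curve hreg hV (k := fun σ => (k₁ σ)⁻¹) hk₁' hB.emb w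
  have hBx : HasDerivAt (fun σ => hB.U ρ K H₀ (τ σ) (hB.emb (ρK (k₂ s₀) u)))
      (τ' • hB.U ρ K H₀ (τ s₀) (hB.emb (ρ H₀ (ρK (k₂ s₀) u)))) s₀ := by
    have h := (hB.hasDerivAt_U_emb hK hXH hbH (ρK (k₂ s₀) u) (τ s₀)).scomp s₀ hτ
    simpa [Function.comp_def] using h
  have hL := hasDerivAt_inner_family_apply (fun σ => hB.U ρ K H₀ (τ σ)) (M := 1)
    (fun σ => ContinuousLinearMap.opNorm_le_bound _ zero_le_one fun z => by rw [hB.norm_U hK.le hXH hbH, one_mul])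
    (fun z => ContinuousAt.comp (f := τ) (g := fun t => hB.U ρ K H₀ t z) (hB.continuous_U_apply hK hXH hbH z).continuousAt hτ.continuousAt)
    hx hy hBx
  refine hL.congr_deriv ?_
  -- (3) reassemble the derivative
  set k1 := k₁ s₀ with hk1
  set k2 := k₂ s₀ with hk2
  set τ₀ := τ s₀ with hτ₀
  set f : V := ρK k2 u with hf
  set w' : V := ρK k1⁻¹ w with hw'
  -- `ρK k₂ (ρ Y₂ u) = ρ (Ad k₂ Y₂) f`, `ρK k₁⁻¹ (ρ Y₁' w) = −ρ Y₁ w'`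
  have hxs : ρK k2 (ρ (LieSubalgebra.inclusion (uFormGroup α β).compactLie_le_lie Y₂) u) =
      ρ ((uFormGroup α β).Ad (Subgroup.inclusion (uFormGroup α β).maximalCompact_le_carrier k2) (LieSubalgebra.inclusion (uFormGroup α β).compactLie_le_lie Y₂)) f :=
    rhoK_rho_apply hV k2 _ u
  have hys : ρK k1⁻¹ (ρ (LieSubalgebra.inclusion (uFormGroup α β).compactLie_le_lie Y₁') w) =
      -ρ (LieSubalgebra.inclusion (uFormGroup α β).compactLie_le_lie Y₁) w' := by
    rw [rhoK_rho_apply hV k1⁻¹ _ w, hY₁', map_neg, map_neg, LinearMap.neg_apply]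
    congr 2
    have : Subgroup.inclusion (uFormGroup α β).maximalCompact_le_carrier k1⁻¹ = (Subgroup.inclusion (uFormGroup α β).maximalCompact_le_carrier k1)⁻¹ := map_inv _ _
    rw [this]
    congr 1
    rw [← LieHom.comp_apply, ← RealMatrixGroup.Ad_mul, inv_mul_cancel, RealMatrixGroup.Ad_one, LieHom.id_apply]
  -- the weak `Ad`-identity for the `k₁`-term
  have hP3 := hB.inner_U_emb_Ad hK hskew hFB H₀ (LieSubalgebra.inclusion (uFormGroup α β).compactLie_le_lie Y₁) τ₀ f w'
  -- `ρ (Ad k₂ H₀) f = ρK k₂ (ρ H₀ u)`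
  have hAdH : ρ ((uFormGroup α β).Ad (Subgroup.inclusion (uFormGroup α β).maximalCompact_le_carrier k2) H₀) f = ρK k2 (ρ H₀ u) := (rhoK_rho_apply hV k2 H₀ u).symm
  -- assemble
  rw [hxs, hys, map_neg, inner_neg_right, ← hAdH, ← hE1]
  simp only [map_add, LinearMap.add_apply, inner_add_left, map_smul, LinearMap.smul_apply]
  rw [← hP3]
  -- the `τ'`-term: real scalar
  have hτterm : ⟪τ' • hB.U ρ K H₀ τ₀ (hB.emb (ρ H₀ f)), hB.emb w'⟫_ℂ = ⟪hB.U ρ K H₀ τ₀ (hB.emb (τ' • ρ H₀ f)), hB.emb w'⟫_ℂ := by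
    rw [LinearMap.map_smul_of_tower hB.emb, ContinuousLinearMap.map_smul_of_tower]
  rw [hτterm]
  abel

end Deriv

end IsPosDefHerm

end Literature.NumberTheory.Automorphic

end
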